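import Mathlib.Algebra.MvPolynomial.PDeriv
import Literature.AlgebraicGeometry.HodgeTheory.HypersurfaceGeometricGenus
import Literature.AlgebraicGeometry.HodgeTheory.HypersurfaceComplexPoints
import HarnessLib

/-!
# Residue forms on smooth hypersurfaces: reduction of the analytic geometric genus to the
Jacobian criterion and Griffiths' residue

Family `hodge`, layer `Literature/AlgebraicGeometry/HodgeTheory`. Second layer of the
decomposition of `Hartshorne1977_hypersurface_exists_holomorphicTopForm`
(file `HypersurfaceHolomorphicForms`), whose geometric core is the named fact
`Hartshorne1977_hypersurface_geometricGenus_pos` (file `HypersurfaceGeometricGenus`): every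
Hodge model `A` of a smooth hypersurface `Y ⊂ ℙ^{m+1}_ℂ` of degree `d ≥ m + 2` carries a non-zero
`m`-form holomorphic in charts. The analytic proof in print (Griffiths 1969; Voisin II, §6.1) is
the **Poincaré residue**: with `F = 0` the equation of `Y`, `Ω = Σ (-1)ⁱ Xᵢ dX₀ ∧ ⋯ ∧ d̂Xᵢ ∧ ⋯`
the generator of `H⁰(ℙⁿ, K_{ℙⁿ}(n+1))` and `P` homogeneous of degree `d - m - 2 ≥ 0`, the residue
`Res_Y(PΩ/F)` is a holomorphic `m`-form on `Y`, non-zero for `P ≠ 0` (Voisin II, Thm. 6.10 /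
Cor. 6.12 at `p = 1`: `S^{d-m-2} = R_F^{d-m-2} ↪ H^{m,0}(Y)`); locally, where `∂F/∂X_j ≠ 0`, it is
`± P dx₀ ∧ ⋯ (omit i, j) ⋯ ∧ dx_{m+1} / (∂f/∂x_j)` in the affine coordinates of `U_i = {X_i ≠ 0}`,
and smoothness of `Y` (the Jacobian criterion) guarantees that these charts cover `Y`. This file
cuts that proof into two named facts plus the proved comparison of complex points
(`hypersurface_complexPoints`, file `HypersurfaceComplexPoints`), and PROVES the assembly:

* `Hartshorne1977_smoothHypersurface_jacobian` (scheme theory; Hartshorne I Thm. 5.1, Ex. 5.8,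
  III Example 10.0.3): for a smooth hypersurface `Y`, reduced and closed-immersed onto `V₊(F)` with
  `F` irreducible homogeneous, the gradient of `F` vanishes at no non-zero zero of `F`;
* `Voisin2003_hypersurface_residueForm` (complex analysis; Voisin II §6.1.1, §6.1.3, Cor. 6.12 at
  `p = 1`): a compact complex `m`-manifold `M` mapped by a topological embedding `ψ` onto
  `{[z] | F(z) = 0} ⊂ ℙ ℂ ℂ^{m+2}`, `F` homogeneous of degree `d ≥ m + 2` with nowhere-vanishing
  gradient on its cone, such that the affine coordinates `z_k/z_i ∘ ψ` are holomorphic, carries a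
  non-zero `m`-form holomorphic in charts (the pull-back `ψ^* Res_Y(PΩ/F)`; non-vanishing because
  `ψ`, a holomorphic homeomorphism onto the complex manifold `V(F)`, has an invertible differential
  somewhere — Sard);
* `Hartshorne1977_hypersurface_geometricGenus_pos_of` (proved): the two facts imply
  `Hartshorne1977_hypersurface_geometricGenus_pos`, with `M = A.carrier`,
  `ψ = hypersurfacePoint ι ∘ A.toComplexPoints` (an embedding onto `{F = 0}` by
  `hypersurface_complexPoints`), holomorphy of the coordinates from `A.isAnalytification` (regular
  functions pull back to holomorphic functions) and compactness from
  `HodgeModel.compactSpace_carrier`.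

## References

* R. Hartshorne, *Algebraic Geometry* (1977), I Thm. 5.1, Ex. 5.8; II Example 3.2.6, Ex. 3.11,
  Example 8.20.3; III Example 10.0.3.
* C. Voisin, *Hodge Theory and Complex Algebraic Geometry II* (2003), §6.1.1, §6.1.3, Thm. 6.10,
  Cor. 6.12.
* P. Griffiths, On the periods of certain rational integrals I, Ann. of Math. 90 (1969).
* J.-P. Serre, *Géométrie algébrique et géométrie analytique*, Ann. Inst. Fourier 6 (1956), §2.
-/

noncomputable section

open scoped Manifold ContDiff Topology LinearAlgebra.Projectivization
open Set AlgebraicGeometry CategoryTheory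

namespace Literature.AlgebraicGeometry.HodgeTheory

/-- **Jacobian criterion for smooth hypersurfaces** (named fact). Let `Y` be a smooth projective
`n`-fold over `ℂ` which is the hypersurface cut out by the irreducible homogeneous form `F` of
degree `d` in `ℙ^{n+1}_ℂ` (`Motives.IsHypersurfaceCutOutBy`: `Y` reduced, closed-immersed with
image `V₊(F)`). Then at every non-zero `z ∈ ℂ^{n+2}` with `F(z) = 0` some partial derivative
`∂F/∂X_j(z)` is non-zero. In print: `Y`, being reduced with support `V₊(F)`, is the reduced induced
structure `Proj ℂ[X]/(F)` (`(F)` is prime; Hartshorne II Example 3.2.6, Ex. 3.11 (c)); smooth over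
`ℂ = ℂ̄` means all local rings regular (III Example 10.0.3), and for the projective variety
`V₊(F)` with ideal `(F)` the point `P = (a₀, …, a_{n+1})` is nonsingular iff the Jacobian matrix
`(∂F/∂X_j(a))` has rank `(n+1) - n = 1` (I Ex. 5.8, from the affine criterion I Thm. 5.1 and
Euler's lemma). [cite: Hartshorne1977, I Thm. 5.1 and Ex. 5.8; III Example 10.0.3] -/
def Hartshorne1977_smoothHypersurface_jacobian : Prop :=
  ∀ (n d : ℕ) (Y : Motives.SchemeOver ℂ) (F : MvPolynomial (Fin (n + 2)) ℂ),
    Motives.IsSmoothProjective n Y → F.IsHomogeneous d → Irreducible F →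
      Motives.IsHypersurfaceCutOutBy (n + 1) F Y →
        ∀ z : Fin (n + 2) → ℂ, z ≠ 0 → MvPolynomial.eval z F = 0 →
          ∃ j, MvPolynomial.eval z (MvPolynomial.pderiv j F) ≠ 0

/-- **Griffiths' residue form of a smooth hypersurface, on a holomorphic model** (named fact). Let
`F ∈ ℂ[X₀, …, X_{m+1}]` be homogeneous of degree `d ≥ m + 2` (`m ≥ 1`) with non-vanishing
gradient at the non-zero zeros of `F` (so `Y = {[z] | F(z) = 0} ⊂ ℙ^{m+1}(ℂ)` is a compact
complex submanifold of dimension `m`). Let `M` be a compact Hausdorff complex manifold with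
holomorphic atlas charted on `E`, `dim_ℂ E = m`, and `ψ : M → ℙ ℂ ℂ^{m+2}` a topological embedding
with image `Y` such that every affine coordinate `z_k/z_i ∘ ψ` is holomorphic on `ψ⁻¹(U_i)`. Then
`M` carries a non-zero complex `m`-form holomorphic in charts
(`Literature.Geometry.Kaehler.IsHolomorphicInCharts`). In print: for `P ∈ S^{d-m-2}`, `P ≠ 0`,
the residue `Res_Y(PΩ/F)` of the meromorphic form `PΩ/F`,
`Ω = Σᵢ (-1)ⁱ Xᵢ dX₀ ∧ ⋯ ∧ d̂Xᵢ ∧ ⋯ ∧ dX_{m+1}` (Voisin II, §6.1.1: `Res(α ∧ dF/F) = α|_Y`;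
§6.1.3: the map `α₁`), is a holomorphic `m`-form on `Y`, and it is non-zero because the kernel of
`ᾱ₁ : S^{d-m-2} → H^{m,0}(Y)` is `J_F^{d-m-2} = 0` (Thm. 6.10, Cor. 6.12 at `p = 1`); locally on
`U_i ∩ {∂F/∂X_j ≠ 0}` it reads `± P dx₀ ∧ ⋯ (omit i, j) ⋯ ∧ dx_{m+1} / (∂f/∂x_j)`. Its pull-back
`ψ^*` to `M` (composition with the holomorphic coordinate functions `z_k/z_i ∘ ψ`) is holomorphic
in charts, and non-zero since the holomorphic homeomorphism `ψ : M → Y` has somewhere an invertible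
differential (Sard). [cite: VoisinHodgeII2003, §6.1.1, §6.1.3, Thm. 6.10 and Cor. 6.12 (p = 1)]
[cite: Hartshorne1977, II Example 8.20.3] -/
def Voisin2003_hypersurface_residueForm : Prop :=
  ∀ (m d : ℕ), 1 ≤ m → m + 2 ≤ d → ∀ (F : MvPolynomial (Fin (m + 2)) ℂ), F.IsHomogeneous d →
    (∀ z : Fin (m + 2) → ℂ, z ≠ 0 → MvPolynomial.eval z F = 0 →
      ∃ j, MvPolynomial.eval z (MvPolynomial.pderiv j F) ≠ 0) →
    ∀ (E : Type) [NormedAddCommGroup E] [NormedSpace ℂ E] [FiniteDimensional ℂ E]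
      (M : Type) [TopologicalSpace M] [ChartedSpace E M] [IsManifold 𝓘(ℂ, E) ω M]
      [IsManifold 𝓘(ℝ, E) ∞ M] [T2Space M] [CompactSpace M],
      Module.finrank ℂ E = m →
      ∀ ψ : M → ℙ ℂ (Fin (m + 2) → ℂ), Topology.IsEmbedding ψ →
        Set.range ψ = Projectivization.projZeroLocus {F} →
        (∀ (i : Fin (m + 2)) (j : Fin (m + 1)),
          MDifferentiableOn 𝓘(ℂ, E) 𝓘(ℂ, ℂ) (fun x ↦ Projectivization.stdChart i (ψ x) j)
            (ψ ⁻¹' (Projectivization.stdChart i).source)) →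
        ∃ η : Literature.Geometry.Kaehler.MForm 𝓘(ℝ, E) M ℂ m,
          Literature.Geometry.Kaehler.IsHolomorphicInCharts η ∧ η ≠ 0

/-- **Assembly: the analytic geometric genus of smooth hypersurfaces from the Jacobian criterion
and the residue form.** Given the two named facts above, every Hodge model `A` of a smooth
hypersurface `Y ⊂ ℙ^{m+1}_ℂ` of degree `d ≥ m + 2` carries a non-zero `m`-form holomorphic in
charts (`Hartshorne1977_hypersurface_geometricGenus_pos`): with `F`, `ι` the witnesses of
`Motives.IsSmoothHypersurface`, take `M = A.carrier` (compact by `HodgeModel.compactSpace_carrier`,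
holomorphic atlas of dimension `m` by the `HodgeModel` fields and `A.isAnalytification.finrank_eq`)
and `ψ = hypersurfacePoint ι ∘ A.toComplexPoints`, an embedding onto `{F = 0}` by the proved
comparison `hypersurface_complexPoints` (`A.toComplexPoints` is a homeomorphism); the affine
coordinates `z_k/z_i ∘ ψ` are values of regular functions on the affine opens `ι⁻¹(D₊(X_i))`
composed with `A.toComplexPoints`, hence holomorphic by
`A.isAnalytification.mdifferentiableOn_evalOrZero` (regular functions pull back to holomorphic
functions on an analytification, Serre GAGA §2).
[cite: VoisinHodgeII2003, §6.1.3 and Cor. 6.12 (p = 1)] [cite: Hartshorne1977, II Example 8.20.3] -/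
theorem Hartshorne1977_hypersurface_geometricGenus_pos_of
    (h₁ : Hartshorne1977_smoothHypersurface_jacobian)
    (h₃ : Voisin2003_hypersurface_residueForm) :
    Hartshorne1977_hypersurface_geometricGenus_pos := by
  intro m d hm hd Y hY A
  obtain ⟨F, hF, hirr, hcut⟩ := hY.2
  have hjac := h₁ m d Y F hY.1 hF hirr hcut
  obtain ⟨_, ι, hι, hrange⟩ := hcut
  obtain ⟨hemb, hrangeψ, hcoord⟩ := hypersurface_complexPoints ι hF hrange
  haveI : CompactSpace A.carrier := A.compactSpace_carrier hY.1
  set ψ : A.carrier → ℙ ℂ (Fin (m + 2) → ℂ) := hypersurfacePoint ι ∘ A.toComplexPoints with hψ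
  have hψemb : Topology.IsEmbedding ψ :=
    hemb.comp A.isAnalytification.homeomorph.isEmbedding
  have hψrange : Set.range ψ = Projectivization.projZeroLocus {F} := by
    rw [hψ, Set.range_comp, A.isAnalytification.isHomeomorph.surjective.range_eq, Set.image_univ,
      hrangeψ]
  refine h₃ m d hm hd F hF hjac A.model A.carrier A.isAnalytification.finrank_eq ψ hψemb hψrange ?_
  intro i j
  obtain ⟨U, hU, hs⟩ := hcoord i
  obtain ⟨s, hs⟩ := hs j
  have hhol := A.isAnalytification.mdifferentiableOn_evalOrZero U s
  have hset : ψ ⁻¹' (Projectivization.stdChart i).source =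
      A.toComplexPoints ⁻¹' {P | P.pt ∈ (↑U : Y.left.Opens)} := by
    rw [hU, hψ, Set.preimage_comp]
  rw [hset]
  exact hhol.congr fun x hx ↦ (hs (A.toComplexPoints x) hx).symm

end Literature.AlgebraicGeometry.HodgeTheory

end
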